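import Mathlib
import Summits.PneNP.PneNP.Theorems.ClusUniversalCertificateCoordBlkDefs
import Summits.PneNP.PneNP.Theorems.ClusUniversalCertificateCoordBookBlk
import Summits.PneNP.PneNP.Theorems.ClusUniversalCertificateCoordZeroFree

/-!
# Route ClusUniversalCertificate, crux `UniversalCertAll` — path `coord`: the GAUGE (TWIST) BOUND for the block step

Support file for `stmt-PneNP-19683` (cell pnp-ideate, route `ClusUniversalCertificate`, rung F-N1; path `coord` of pnp-ideate-p1,
skeleton v11 sha16 e5cba65d, block disjunct of the peel conjecture `stub_peelZeroRare3`; objects of record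
`ClusUniversalCertificateCoordDefs.lean` p516754 / `…CoordBlkDefs.lean` p519312, namespace `…Theorems.ClusCoord`).
Kernel form, in the mixed-block setting and for LINEAR gauges, of p1's TWIST BOUND (ROUND-6 §F2):

Fix a block `k`, the deletion `π` of block `k` (`delBlk`, along `kemb`) and a linear GAUGE `H : 𝔽₂^{M'} → 𝔽₂^M` with values
supported on block `k`.  Colour the points of `Y` by `Φ_H y := π_k y − H(π y)` (`π_k` = `blockProj`, the block-`k` part); the colour
classes, projected by `π`, form the GAUGE FAMILY `gaugeFamily` (for `H = 0`: the SLICES of block `k`).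

* `isBLayerFamily_gaugeFamily`: it is a block layer family (a point is determined by its colour and its projection);
* `dsum_le_gaugeFamily`: `D(Y) ≤ Σ_{S ∈ gaugeFamily} D(S) + (bsize k − 1)|Y| + #twisted_H(Y)`, where `y` is `H`-TWISTED
  (`Twisted`) iff EVERY optimal flat `A ∋ y` inside `Y` has full `Φ_H`-rank `bsize k` on its direction.  Mechanism: the colour
  class of `y` inside a flat `A ∋ y` is the flat `y + (A.direction ⊓ ker Φ_H)`, `π` is injective on `ker Φ_H`, so the member of `y`
  keeps dimension `dim A − rank(Φ_H|A.direction) ≥ dim A − bsize k`, and one more unless `y` is twisted;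
* `peelBlock_of_twisted_le`: hence `#twisted_H(Y) ≤ 2^{bsize k}·Z_k(Y)` gives a block layer family satisfying the block layer
  inequality `BLayerIneq` — the block disjunct of `stub_peelZeroRare3` (with the identity change of coordinates) for `(Y, k)`.

FRONTIER rung F-N1 (a combinatorial certificate about affine flats in `𝔽₂^M`); a SUFFICIENT condition only — the conjecture and the
crux are OPEN; nothing here bears on P vs NP.
-/

set_option linter.dupNamespace false -- `Summit.PneNP.PneNP.…`: summit = sub-problem name (D-0017 single-conjunct layout)

namespace Summit.PneNP.PneNP.Theorems.ClusCoordGauge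

open Finset
open Summit.PneNP.PneNP.Theorems.ClusCoord (acodim dsum bsize zcount UCMix kemb IsBLayerFamily BLayerIneq)
open Summit.PneNP.PneNP.Theorems.ClusCoordBookBlk (blk_kemb_ne exists_kemb_eq)
open Summit.PneNP.PneNP.Theorems.ClusCoordZeroFree (blockProj blockProj_apply)

variable {M M' n : ℕ}

/-! ## Deleting a block, linearly -/

/-- Deleting block `k` (keeping the coordinates outside it, in order) as a linear map. -/
noncomputable def delBlk (blk : Fin M → Fin n) (k : Fin n) (M' : ℕ) (h : (univ.filter fun i => blk i ≠ k).card = M') :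
    (Fin M → ZMod 2) →ₗ[ZMod 2] (Fin M' → ZMod 2) :=
  LinearMap.funLeft (ZMod 2) (ZMod 2) (kemb blk k M' h)

/-- `delBlk` is the restriction to the coordinates outside block `k`. -/
theorem delBlk_apply (blk : Fin M → Fin n) (k : Fin n) (M' : ℕ) (h : (univ.filter fun i => blk i ≠ k).card = M')
    (v : Fin M → ZMod 2) : delBlk blk k M' h v = fun j => v (kemb blk k M' h j) := rfl

/-- A vector is determined by its block-`k` part and its coordinates outside block `k`. -/
theorem eq_zero_of_blockProj_of_delBlk (blk : Fin M → Fin n) (k : Fin n) (M' : ℕ)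
    (h : (univ.filter fun i => blk i ≠ k).card = M') (v : Fin M → ZMod 2)
    (h1 : blockProj blk k v = 0) (h2 : delBlk blk k M' h v = 0) : v = 0 := by
  funext i
  by_cases hi : blk i = k
  · have := congrFun h1 i
    rw [blockProj_apply, if_pos hi] at this
    exact this
  · obtain ⟨l, hl⟩ := exists_kemb_eq blk k h i hi
    have := congrFun h2 l
    rw [delBlk_apply] at this
    rw [← hl]
    exact this

/-! ## Gauges, colours and the gauge family -/

/-- The colouring map of the gauge `H`: block `k` minus the gauge value of the other coordinates. -/
noncomputable def gaugeMap (blk : Fin M → Fin n) (k : Fin n) (M' : ℕ) (h : (univ.filter fun i => blk i ≠ k).card = M')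
    (H : (Fin M' → ZMod 2) →ₗ[ZMod 2] (Fin M → ZMod 2)) : (Fin M → ZMod 2) →ₗ[ZMod 2] (Fin M → ZMod 2) :=
  blockProj blk k - H ∘ₗ delBlk blk k M' h

/-- The member of colour `c`: the projection of the colour class. -/
noncomputable def gaugeMember (blk : Fin M → Fin n) (Y : Finset (Fin M → ZMod 2)) (k : Fin n) (M' : ℕ)
    (h : (univ.filter fun i => blk i ≠ k).card = M') (H : (Fin M' → ZMod 2) →ₗ[ZMod 2] (Fin M → ZMod 2))
    (c : Fin M → ZMod 2) : Finset (Fin M' → ZMod 2) :=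
  (Y.filter fun y => gaugeMap blk k M' h H y = c).image (delBlk blk k M' h)

/-- The GAUGE FAMILY of `(Y, k, H)`: all colour classes, projected (one member per colour; empty members are harmless). -/
noncomputable def gaugeFamily (blk : Fin M → Fin n) (Y : Finset (Fin M → ZMod 2)) (k : Fin n) (M' : ℕ)
    (h : (univ.filter fun i => blk i ≠ k).card = M') (H : (Fin M' → ZMod 2) →ₗ[ZMod 2] (Fin M → ZMod 2)) :
    List (Finset (Fin M' → ZMod 2)) :=
  (univ : Finset (Fin M → ZMod 2)).toList.map (gaugeMember blk Y k M' h H)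

/-- Points with the same colour and the same projection are equal. -/
theorem eq_of_gaugeMap_eq_of_delBlk_eq (blk : Fin M → Fin n) (k : Fin n) (M' : ℕ)
    (h : (univ.filter fun i => blk i ≠ k).card = M') (H : (Fin M' → ZMod 2) →ₗ[ZMod 2] (Fin M → ZMod 2))
    {y y' : Fin M → ZMod 2}
    (hc : gaugeMap blk k M' h H y = gaugeMap blk k M' h H y') (hp : delBlk blk k M' h y = delBlk blk k M' h y') :
    y = y' := by
  have hv2 : delBlk blk k M' h (y - y') = 0 := by rw [map_sub, hp, sub_self]
  have hΦ : gaugeMap blk k M' h H (y - y') = 0 := by rw [map_sub, hc, sub_self]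
  have hv1 : blockProj blk k (y - y') = 0 := by
    have : gaugeMap blk k M' h H (y - y') = blockProj blk k (y - y') - H (delBlk blk k M' h (y - y')) := rfl
    rw [this, hv2, map_zero, sub_zero] at hΦ
    exact hΦ
  exact sub_eq_zero.mp (eq_zero_of_blockProj_of_delBlk blk k M' h _ hv1 hv2)

/-- Filtering a `Finset.toList` and counting = the cardinality of the filtered finset. -/
theorem length_filter_toList {α : Type*} (s : Finset α) (p : α → Prop) [DecidablePred p] :
    (s.toList.filter fun a => p a).length = (s.filter p).card := by
  rw [← Multiset.coe_card, ← Multiset.filter_coe, Finset.coe_toList, Finset.card_def, Finset.filter_val]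

/-- **The gauge family is a block layer family.** -/
theorem isBLayerFamily_gaugeFamily (blk : Fin M → Fin n) (Y : Finset (Fin M → ZMod 2)) (k : Fin n) (M' : ℕ)
    (h : (univ.filter fun i => blk i ≠ k).card = M') (H : (Fin M' → ZMod 2) →ₗ[ZMod 2] (Fin M → ZMod 2)) :
    IsBLayerFamily blk Y k M' h (gaugeFamily blk Y k M' h H) := by
  intro x
  unfold gaugeFamily
  rw [List.filter_map, List.length_map]
  have hlen : ((univ : Finset (Fin M → ZMod 2)).toList.filter
      ((fun S : Finset (Fin M' → ZMod 2) => decide (x ∈ S)) ∘ gaugeMember blk Y k M' h H)).length =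
      ((univ : Finset (Fin M → ZMod 2)).filter fun c => x ∈ gaugeMember blk Y k M' h H c).card := by
    rw [← length_filter_toList]
    rfl
  rw [hlen]
  -- the colours whose member contains `x` are the colours of the fibre over `x`
  have hset : ((univ : Finset (Fin M → ZMod 2)).filter fun c => x ∈ gaugeMember blk Y k M' h H c) =
      (Y.filter fun y => (fun j => y (kemb blk k M' h j)) = x).image (gaugeMap blk k M' h H) := by
    ext c
    simp only [Finset.mem_filter, Finset.mem_univ, true_and, Finset.mem_image, gaugeMember]
    constructor
    · rintro ⟨y, ⟨hy, hyc⟩, hyx⟩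
      exact ⟨y, ⟨hy, hyx⟩, hyc⟩
    · rintro ⟨y, ⟨hy, hyx⟩, hyc⟩
      exact ⟨y, ⟨hy, hyc⟩, hyx⟩
  rw [hset, Finset.card_image_of_injOn]
  rintro y hy y' hy' hc
  have hyx := (Finset.mem_filter.1 (Finset.mem_coe.1 hy)).2
  have hy'x := (Finset.mem_filter.1 (Finset.mem_coe.1 hy')).2
  exact eq_of_gaugeMap_eq_of_delBlk_eq blk k M' h H hc (by rw [delBlk_apply, delBlk_apply, hyx, hy'x])

/-! ## Optimal flats and the rank of the gauge on a flat -/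

/-- Every point of `Y` has an OPTIMAL flat: one through it, inside `Y`, realising `acodim`. -/
theorem exists_optimal (Y : Finset (Fin M → ZMod 2)) (y : Fin M → ZMod 2) (hy : y ∈ Y) :
    ∃ A : AffineSubspace (ZMod 2) (Fin M → ZMod 2), y ∈ A ∧ (∀ z ∈ A, z ∈ Y) ∧
      M ≤ Module.finrank (ZMod 2) A.direction + acodim M Y y := by
  have hne : {c : ℕ | ∃ A : AffineSubspace (ZMod 2) (Fin M → ZMod 2), y ∈ A ∧ (∀ z ∈ A, z ∈ Y) ∧
      M ≤ Module.finrank (ZMod 2) A.direction + c}.Nonempty := by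
    refine ⟨M, AffineSubspace.mk' y ⊥, AffineSubspace.self_mem_mk' _ _, ?_, by simp⟩
    intro z hz
    rw [AffineSubspace.mem_mk'] at hz
    have : z = y := by
      rw [Submodule.mem_bot, vsub_eq_sub, sub_eq_zero] at hz
      exact hz
    rw [this]
    exact hy
  exact Nat.sInf_mem hne

/-- The gauge map takes values supported on block `k`, so its rank on any subspace is at most `bsize k`. -/
theorem finrank_map_gaugeMap_le (blk : Fin M → Fin n) (k : Fin n) (M' : ℕ)
    (h : (univ.filter fun i => blk i ≠ k).card = M') (H : (Fin M' → ZMod 2) →ₗ[ZMod 2] (Fin M → ZMod 2))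
    (hH : ∀ x, blockProj blk k (H x) = H x) (D : Submodule (ZMod 2) (Fin M → ZMod 2)) :
    Module.finrank (ZMod 2) (D.map (gaugeMap blk k M' h H)) ≤ bsize blk k := by
  -- the span of the unit vectors of block `k`
  set W : Submodule (ZMod 2) (Fin M → ZMod 2) :=
    Submodule.span (ZMod 2) (((univ.filter fun i => blk i = k).image fun i => Pi.single i (1 : ZMod 2)) : Set _) with hW
  have hsupp : ∀ v : Fin M → ZMod 2, (∀ i, blk i ≠ k → v i = 0) → v ∈ W := by
    intro v hv
    rw [pi_eq_sum_univ v]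
    refine Submodule.sum_mem _ fun i _ => ?_
    by_cases hi : blk i = k
    · refine Submodule.smul_mem _ _ (Submodule.subset_span ?_)
      rw [Finset.coe_image]
      refine ⟨i, by simp [hi], ?_⟩
      funext j
      simp [Pi.single_apply, eq_comm]
    · rw [hv i hi, zero_smul]
      exact Submodule.zero_mem _
  have hle : D.map (gaugeMap blk k M' h H) ≤ W := by
    rintro w ⟨v, -, rfl⟩
    apply hsupp
    intro i hi
    have : gaugeMap blk k M' h H v = blockProj blk k v - H (delBlk blk k M' h v) := rfl
    rw [this, Pi.sub_apply, blockProj_apply, if_neg hi, ← hH (delBlk blk k M' h v), blockProj_apply, if_neg hi, sub_zero]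
  calc Module.finrank (ZMod 2) (D.map (gaugeMap blk k M' h H)) ≤ Module.finrank (ZMod 2) W := Submodule.finrank_mono hle
    _ ≤ ((univ.filter fun i => blk i = k).image fun i => Pi.single i (1 : ZMod 2)).card := by
        rw [hW]; exact finrank_span_finset_le_card _
    _ ≤ (univ.filter fun i => blk i = k).card := Finset.card_image_le
    _ = bsize blk k := rfl

/-- **The member of `y` keeps `dim A − rank(Φ_H | A.direction)` dimensions**: for every flat `A ∋ y` inside `Y`,
`acodim` of `π y` in the member of colour `Φ_H y` is at most `M' − (finrank A.direction − finrank (A.direction.map Φ_H))`. -/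
theorem acodim_member_le (blk : Fin M → Fin n) (Y : Finset (Fin M → ZMod 2)) (k : Fin n) (M' : ℕ)
    (h : (univ.filter fun i => blk i ≠ k).card = M') (H : (Fin M' → ZMod 2) →ₗ[ZMod 2] (Fin M → ZMod 2))
    (A : AffineSubspace (ZMod 2) (Fin M → ZMod 2)) (y : Fin M → ZMod 2)
    (hyA : y ∈ A) (hAY : ∀ z ∈ A, z ∈ Y) :
    acodim M' (gaugeMember blk Y k M' h H (gaugeMap blk k M' h H y)) (delBlk blk k M' h y) +
        Module.finrank (ZMod 2) A.direction ≤
      M' + Module.finrank (ZMod 2) (A.direction.map (gaugeMap blk k M' h H)) := by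
  set Φ := gaugeMap blk k M' h H with hΦ
  set π := delBlk blk k M' h with hπ
  set D := A.direction with hD
  -- the kernel of `Φ` on `D`, as a submodule of `D`, and its image under `π`
  set K : Submodule (ZMod 2) D := (LinearMap.ker Φ).comap D.subtype with hK
  set E : Submodule (ZMod 2) (Fin M' → ZMod 2) := K.map (π ∘ₗ D.subtype) with hE
  -- rank–nullity on `D`
  have hrn : Module.finrank (ZMod 2) (D.map Φ) + Module.finrank (ZMod 2) K = Module.finrank (ZMod 2) D := by
    have := LinearMap.finrank_range_add_finrank_ker (Φ.domRestrict D)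
    rw [LinearMap.range_domRestrict, LinearMap.ker_domRestrict] at this
    exact this
  -- `π` is injective on `K`
  have hinj : Function.Injective ((π ∘ₗ D.subtype) ∘ₗ K.subtype) := by
    rw [← LinearMap.ker_eq_bot, LinearMap.ker_eq_bot']
    intro d hd
    have hd0 : Φ ((d : D) : Fin M → ZMod 2) = 0 := LinearMap.mem_ker.mp (Submodule.mem_comap.mp d.2)
    have hπ0 : π ((d : D) : Fin M → ZMod 2) = 0 := hd
    have hb : blockProj blk k ((d : D) : Fin M → ZMod 2) = 0 := by
      have : Φ ((d : D) : Fin M → ZMod 2) = blockProj blk k ((d : D) : Fin M → ZMod 2) - H (π ((d : D) : Fin M → ZMod 2)) := rfl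
      rw [this, hπ0, map_zero, sub_zero] at hd0
      exact hd0
    have := eq_zero_of_blockProj_of_delBlk blk k M' h _ hb hπ0
    exact Subtype.ext (Subtype.ext this)
  have hEK : Module.finrank (ZMod 2) E = Module.finrank (ZMod 2) K := by
    rw [hE, ← LinearMap.finrank_range_of_inj hinj, LinearMap.range_comp, Submodule.range_subtype]
  -- the flat `π y + E` lies inside the member of `y`
  have hflat : acodim M' (gaugeMember blk Y k M' h H (Φ y)) (π y) ≤ M' - Module.finrank (ZMod 2) E := by
    unfold acodim
    apply Nat.sInf_le
    refine ⟨AffineSubspace.mk' (π y) E, AffineSubspace.self_mem_mk' _ _, ?_, ?_⟩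
    · intro w hw
      rw [AffineSubspace.mem_mk', hE, Submodule.mem_map] at hw
      obtain ⟨d, hdK, hdw⟩ := hw
      have hd0 : Φ ((d : D) : Fin M → ZMod 2) = 0 := LinearMap.mem_ker.mp (Submodule.mem_comap.mp hdK)
      have hzA : ((d : D) : Fin M → ZMod 2) +ᵥ y ∈ A := AffineSubspace.vadd_mem_of_mem_direction d.2 hyA
      have hw' : w = π (((d : D) : Fin M → ZMod 2) +ᵥ y) := by
        rw [vadd_eq_add, map_add]
        have : (π ∘ₗ D.subtype) d = w -ᵥ π y := hdw
        rw [LinearMap.comp_apply, Submodule.subtype_apply] at this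
        rw [this, vsub_eq_sub, sub_add_cancel]
      rw [hw']
      unfold gaugeMember
      apply Finset.mem_image_of_mem
      rw [Finset.mem_filter]
      refine ⟨hAY _ hzA, ?_⟩
      rw [vadd_eq_add, map_add, hd0, zero_add]
    · rw [AffineSubspace.direction_mk']
      have : Module.finrank (ZMod 2) E ≤ M' := by
        have := Submodule.finrank_le E
        rw [Module.finrank_fintype_fun_eq_card, Fintype.card_fin] at this
        exact this
      omega
  have hEle : Module.finrank (ZMod 2) E ≤ M' := by
    have := Submodule.finrank_le E
    rw [Module.finrank_fintype_fun_eq_card, Fintype.card_fin] at this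
    exact this
  rw [hEK] at hflat hEle
  omega

/-! ## Twisted points and the gauge bound -/

/-- `y` is `H`-TWISTED in `Y` (for block `k`): every optimal flat through `y` inside `Y` has full `Φ_H`-rank `bsize k`. -/
def Twisted (blk : Fin M → Fin n) (Y : Finset (Fin M → ZMod 2)) (k : Fin n) (M' : ℕ)
    (h : (univ.filter fun i => blk i ≠ k).card = M') (H : (Fin M' → ZMod 2) →ₗ[ZMod 2] (Fin M → ZMod 2))
    (y : Fin M → ZMod 2) : Prop :=
  ∀ A : AffineSubspace (ZMod 2) (Fin M → ZMod 2), y ∈ A → (∀ z ∈ A, z ∈ Y) →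
    M ≤ Module.finrank (ZMod 2) A.direction + acodim M Y y →
      bsize blk k ≤ Module.finrank (ZMod 2) (A.direction.map (gaugeMap blk k M' h H))

/-- The sum of the members' `dsum` is a sum over the points of `Y`. -/
theorem sum_dsum_gaugeFamily (blk : Fin M → Fin n) (Y : Finset (Fin M → ZMod 2)) (k : Fin n) (M' : ℕ)
    (h : (univ.filter fun i => blk i ≠ k).card = M') (H : (Fin M' → ZMod 2) →ₗ[ZMod 2] (Fin M → ZMod 2)) :
    ((gaugeFamily blk Y k M' h H).map (dsum M')).sum =
      ∑ y ∈ Y, ((M' : ℤ) - (acodim M' (gaugeMember blk Y k M' h H (gaugeMap blk k M' h H y)) (delBlk blk k M' h y) : ℤ)) := by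
  unfold gaugeFamily
  rw [List.map_map, Finset.sum_map_toList]
  -- `Σ_c Σ_{x ∈ member c} = Σ_c Σ_{y ∈ colour class c} = Σ_{y ∈ Y}`
  have hmem : ∀ c : Fin M → ZMod 2, dsum M' (gaugeMember blk Y k M' h H c) =
      ∑ y ∈ Y.filter (fun y => gaugeMap blk k M' h H y = c),
        ((M' : ℤ) - (acodim M' (gaugeMember blk Y k M' h H (gaugeMap blk k M' h H y)) (delBlk blk k M' h y) : ℤ)) := by
    intro c
    unfold dsum
    unfold gaugeMember
    rw [Finset.sum_image]
    · refine Finset.sum_congr rfl fun y hy => ?_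
      rw [(Finset.mem_filter.1 hy).2]
    · intro y hy y' hy' hp
      exact eq_of_gaugeMap_eq_of_delBlk_eq blk k M' h H
        ((Finset.mem_filter.1 (Finset.mem_coe.1 hy)).2.trans (Finset.mem_filter.1 (Finset.mem_coe.1 hy')).2.symm) hp
  simp only [Function.comp_def, hmem]
  exact Finset.sum_fiberwise_of_maps_to (s := Y) (t := univ) (g := gaugeMap blk k M' h H) (fun y _ => Finset.mem_univ _) _

open scoped Classical in
/-- **GAUGE (TWIST) BOUND.**  `D(Y) ≤ Σ_{S ∈ gaugeFamily} D(S) + (bsize k − 1)·|Y| + #twisted_H(Y)`. -/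
theorem dsum_le_gaugeFamily (blk : Fin M → Fin n) (Y : Finset (Fin M → ZMod 2)) (k : Fin n) (M' : ℕ)
    (h : (univ.filter fun i => blk i ≠ k).card = M') (H : (Fin M' → ZMod 2) →ₗ[ZMod 2] (Fin M → ZMod 2))
    (hH : ∀ x, blockProj blk k (H x) = H x) :
    dsum M Y ≤ ((gaugeFamily blk Y k M' h H).map (dsum M')).sum + ((bsize blk k : ℤ) - 1) * (Y.card : ℤ) +
      ((Y.filter (Twisted blk Y k M' h H)).card : ℤ) := by
  rw [sum_dsum_gaugeFamily blk Y k M' h H]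
  unfold dsum
  -- pointwise: `dim_Y y ≤ (member dimension at π y) + bsize k − [y not twisted]`
  have hpt : ∀ y ∈ Y, ((M : ℤ) - (acodim M Y y : ℤ)) ≤
      ((M' : ℤ) - (acodim M' (gaugeMember blk Y k M' h H (gaugeMap blk k M' h H y)) (delBlk blk k M' h y) : ℤ)) +
        (((bsize blk k : ℤ) - 1) + (if Twisted blk Y k M' h H y then (1 : ℤ) else 0)) := by
    intro y hy
    by_cases ht : Twisted blk Y k M' h H y
    · rw [if_pos ht]
      obtain ⟨A, hyA, hAY, hopt⟩ := exists_optimal Y y hy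
      have h1 := acodim_member_le blk Y k M' h H A y hyA hAY
      have h2 := finrank_map_gaugeMap_le blk k M' h H hH A.direction
      have h1' : ((acodim M' (gaugeMember blk Y k M' h H (gaugeMap blk k M' h H y)) (delBlk blk k M' h y) : ℕ) : ℤ) +
          (Module.finrank (ZMod 2) A.direction : ℤ) ≤
          (M' : ℤ) + (Module.finrank (ZMod 2) (A.direction.map (gaugeMap blk k M' h H)) : ℤ) := by exact_mod_cast h1
      have h2' : (Module.finrank (ZMod 2) (A.direction.map (gaugeMap blk k M' h H)) : ℤ) ≤ (bsize blk k : ℤ) := by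
        exact_mod_cast h2
      have hopt' : (M : ℤ) ≤ (Module.finrank (ZMod 2) A.direction : ℤ) + (acodim M Y y : ℤ) := by exact_mod_cast hopt
      linarith
    · rw [if_neg ht]
      unfold Twisted at ht
      push Not at ht
      obtain ⟨A, hyA, hAY, hopt, hlt⟩ := ht
      have h1 := acodim_member_le blk Y k M' h H A y hyA hAY
      have h1' : ((acodim M' (gaugeMember blk Y k M' h H (gaugeMap blk k M' h H y)) (delBlk blk k M' h y) : ℕ) : ℤ) +
          (Module.finrank (ZMod 2) A.direction : ℤ) ≤
          (M' : ℤ) + (Module.finrank (ZMod 2) (A.direction.map (gaugeMap blk k M' h H)) : ℤ) := by exact_mod_cast h1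
      have hlt' : (Module.finrank (ZMod 2) (A.direction.map (gaugeMap blk k M' h H)) : ℤ) + 1 ≤ (bsize blk k : ℤ) := by
        exact_mod_cast hlt
      have hopt' : (M : ℤ) ≤ (Module.finrank (ZMod 2) A.direction : ℤ) + (acodim M Y y : ℤ) := by exact_mod_cast hopt
      linarith
  refine (Finset.sum_le_sum hpt).trans (le_of_eq ?_)
  rw [Finset.sum_add_distrib, Finset.sum_add_distrib, Finset.sum_const, nsmul_eq_mul, Finset.sum_boole]
  ring

open scoped Classical in
/-- **The block disjunct of the peel conjecture from a gauge with few twisted points**: if `#twisted_H(Y) ≤ 2^{bsize k}·Z_k(Y)`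
then the gauge family is a block layer family satisfying the block layer inequality. -/
theorem peelBlock_of_twisted_le (blk : Fin M → Fin n) (Y : Finset (Fin M → ZMod 2)) (k : Fin n) (M' : ℕ)
    (h : (univ.filter fun i => blk i ≠ k).card = M') (H : (Fin M' → ZMod 2) →ₗ[ZMod 2] (Fin M → ZMod 2))
    (hH : ∀ x, blockProj blk k (H x) = H x)
    (htw : ((Y.filter (Twisted blk Y k M' h H)).card : ℤ) ≤ (2 : ℤ) ^ (bsize blk k) * (zcount blk k Y : ℤ)) :
    ∃ L : List (Finset (Fin M' → ZMod 2)), IsBLayerFamily blk Y k M' h L ∧ BLayerIneq M n blk Y k M' L := by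
  refine ⟨gaugeFamily blk Y k M' h H, isBLayerFamily_gaugeFamily blk Y k M' h H, ?_⟩
  unfold BLayerIneq
  have := dsum_le_gaugeFamily blk Y k M' h H hH
  linarith

open scoped Classical in
/-- The SLICE case (`H = 0`): if at most `2^{bsize k}·Z_k(Y)` points of `Y` are fully `k`-twisted (every optimal flat through them has
block-`k` projection of full rank), then the slices of block `k` satisfy the block layer inequality. -/
theorem peelBlock_slices_of_twisted_le (blk : Fin M → Fin n) (Y : Finset (Fin M → ZMod 2)) (k : Fin n) (M' : ℕ)
    (h : (univ.filter fun i => blk i ≠ k).card = M')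
    (htw : ((Y.filter (Twisted blk Y k M' h 0)).card : ℤ) ≤ (2 : ℤ) ^ (bsize blk k) * (zcount blk k Y : ℤ)) :
    ∃ L : List (Finset (Fin M' → ZMod 2)), IsBLayerFamily blk Y k M' h L ∧ BLayerIneq M n blk Y k M' L :=
  peelBlock_of_twisted_le blk Y k M' h 0 (fun x => by simp) htw

end Summit.PneNP.PneNP.Theorems.ClusCoordGauge
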